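import Summits.AtomisticToContinuum.HydrodynamicLimit.Theses.RelayRaceLocality
import Literature.Analysis.FluidPDE.HardSphereAlexander
import Literature.MathematicalPhysics.KineticTheory.HardSphereEulerProofs

/-!
# `GibbsLightCone` without `0 ≤ t`, resp. without `0 < δ`, is FALSE (junk-sign kills)

Negative knowledge for the crux `RelayRaceLocality.GibbsLightCone` (stmt-AtomisticToContinuum-12501),
from the standing disprover's `Cruxes/GibbsLightCone/Disproof.lean` §A4.

The crux asks that `G_N {z | ∃ i j, (j = i ∨ j ∈ BC(i,(0,t])) ∧ c t + δ < dist(x_j(0), x_i(t))} → 0`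
for every `t ≥ 0` and `δ > 0`. Both sign hypotheses act ONLY through the sign of the threshold
`c t + δ`: as soon as it is negative the event is everything (`j = i`, `dist ≥ 0`) and its Gibbs
probability is `1` for every `N` — the laws are probability measures
(`isProbabilityMeasure_localGibbsLaw`, `σ ≤ 1/2`) and flows to test through exist by Alexander's
theorem on `𝕋³` (`HardSphereFlow.nonempty_torus_holds`, PROVED in the tree), so both refutations
are UNCONDITIONAL.

* `GibbsLightConeWithoutNonnegTime` (the crux verbatim with `0 ≤ t →` deleted) is false:
  witness `t = -2/c`, `δ = 1` (threshold `-1`).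
* `GibbsLightConeWithoutPosDelta` (the crux verbatim with `0 < δ →` deleted) is false:
  witness `t = 0`, `δ = -1`.

Moral for provers: nothing — these are typing remarks (for negative times the honest statement has
`c |t|`; `δ = 0` is harmless at `t = 0`, where the event is Gibbs-null, and plausibly for `t > 0`).
They are recorded so that the mutation table of the crux is kernel-checked rather than asserted.
refuter-cdisprove-stmt-AtomisticToContinuum-12501-0.
-/

noncomputable section

namespace Summit.AtomisticToContinuum.HydrodynamicLimit.Theorems

open MeasureTheory Filter Set
open scoped ENNReal Topology
open Literature.MathematicalPhysics.KineticTheory Literature.Analysis.FluidPDE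
open Summit.AtomisticToContinuum.HydrodynamicLimit.Theses.RelayRaceLocality (GibbsLightCone)

/-- The crux `GibbsLightCone` with the hypothesis `0 ≤ t` DELETED (all else verbatim). -/
def GibbsLightConeWithoutNonnegTime : Prop :=
  ∀ a θ : ℝ, 0 < a → 0 < θ → ∃ σ₀ : ℝ, 0 < σ₀ ∧ ∃ c : ℝ, 0 < c ∧ ∀ σ : ℝ, 0 < σ → σ < σ₀ →
    ∀ Φ : (N : ℕ) → HardSphereFlow (Torus.geometry (Fin 3)) (hsDiameter σ N) (N + 1),
    ∀ t : ℝ, ∀ δ : ℝ, 0 < δ →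
      Tendsto (fun N => localGibbsLaw σ (fun _ => a) (fun _ => 0) (fun _ => θ) N (Φ N)
        {z | ∃ i j : Fin (N + 1), (j = i ∨ j ∈ (Φ N).backwardCluster i 0 t z) ∧
          c * t + δ < Torus.euclidDist (z j).1 ((Φ N).flow t z i).1}) atTop (𝓝 0)

/-- The crux `GibbsLightCone` with the hypothesis `0 < δ` DELETED (`δ` ranges over `ℝ`; all else
verbatim). -/
def GibbsLightConeWithoutPosDelta : Prop :=
  ∀ a θ : ℝ, 0 < a → 0 < θ → ∃ σ₀ : ℝ, 0 < σ₀ ∧ ∃ c : ℝ, 0 < c ∧ ∀ σ : ℝ, 0 < σ → σ < σ₀ →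
    ∀ Φ : (N : ℕ) → HardSphereFlow (Torus.geometry (Fin 3)) (hsDiameter σ N) (N + 1),
    ∀ t : ℝ, 0 ≤ t → ∀ δ : ℝ,
      Tendsto (fun N => localGibbsLaw σ (fun _ => a) (fun _ => 0) (fun _ => θ) N (Φ N)
        {z | ∃ i j : Fin (N + 1), (j = i ∨ j ∈ (Φ N).backwardCluster i 0 t z) ∧
          c * t + δ < Torus.euclidDist (z j).1 ((Φ N).flow t z i).1}) atTop (𝓝 0)

namespace GibbsLightConeWithoutNonnegTime

/-- Sanity (contrapositive form, so that no Theses decl is concluded positively): the variant is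
the crux minus exactly `0 ≤ t`. [folklore] -/
theorem not_of_not_crux : ¬ GibbsLightCone → ¬ GibbsLightConeWithoutNonnegTime := by
  intro hn h
  refine hn fun a θ ha hθ => ?_
  obtain ⟨σ₀, hσ₀, c, hc, h⟩ := h a θ ha hθ
  exact ⟨σ₀, hσ₀, c, hc, fun σ hσ hσ' Φ t _ δ hδ => h σ hσ hσ' Φ t δ hδ⟩

/-- A flow to test through: Alexander's theorem on `𝕋³` (`HardSphereFlow.nonempty_torus_holds`,
as used in `KineticFluxLdDecayWithoutOrthogonality.flow_nonempty`) at diameter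
`σ (N+1)^{-1/3} ≤ σ < 1/2`, followed by a choice. [folklore] -/
def someFlow {σ : ℝ} (hσ : 0 < σ) (hσ' : σ < 2⁻¹) (N : ℕ) :
    HardSphereFlow (Torus.geometry (Fin 3)) (hsDiameter σ N) (N + 1) :=
  Classical.choice (HardSphereFlow.nonempty_torus_holds (d := Fin 3) (hsDiameter_pos hσ N)
    ((hsDiameter_le hσ.le N).trans_lt hσ') (N + 1))

/-- A small admissible reduced diameter below any `σ₀ > 0` and below `1/2`. [folklore] -/
theorem exists_sigma {σ₀ : ℝ} (hσ₀ : 0 < σ₀) : ∃ σ : ℝ, 0 < σ ∧ σ < σ₀ ∧ σ < 2⁻¹ :=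
  ⟨min (σ₀ / 2) 4⁻¹, lt_min (by linarith) (by norm_num),
    (min_le_left _ _).trans_lt (by linarith), (min_le_right _ _).trans_lt (by norm_num)⟩

/-- With a negative threshold the crux event is everything (`j = i`, distances are `≥ 0`).
[folklore] -/
theorem event_eq_univ {σ : ℝ} {N : ℕ}
    (Φ : HardSphereFlow (Torus.geometry (Fin 3)) (hsDiameter σ N) (N + 1)) {c t δ : ℝ}
    (h : c * t + δ < 0) :
    {z : Config (N + 1) (Fin 3) T3 | ∃ i j : Fin (N + 1), (j = i ∨ j ∈ Φ.backwardCluster i 0 t z) ∧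
      c * t + δ < Torus.euclidDist (z j).1 (Φ.flow t z i).1} = univ :=
  eq_univ_of_forall fun _ => ⟨0, 0, Or.inl rfl, h.trans_le (norm_nonneg _)⟩

/-- Under the homogeneous Gibbs laws (probability measures for `σ ≤ 1/2`) a sequence of events
that are everything has probability `1`, hence does not tend to `0`. [folklore] -/
theorem not_tendsto_of_eq_univ {σ a θ : ℝ} (ha : 0 < a) (hθ : 0 < θ) (hσ : σ ≤ 1 / 2)
    (Φ : (N : ℕ) → HardSphereFlow (Torus.geometry (Fin 3)) (hsDiameter σ N) (N + 1))
    (E : (N : ℕ) → Set (Config (N + 1) (Fin 3) T3)) (hE : ∀ N, E N = univ) :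
    ¬ Tendsto (fun N => localGibbsLaw σ (fun _ => a) (fun _ => 0) (fun _ => θ) N (Φ N) (E N))
      atTop (𝓝 0) := by
  intro h
  have h1 : (fun N => localGibbsLaw σ (fun _ => a) (fun _ => 0) (fun _ => θ) N (Φ N) (E N)) =
      fun _ => 1 := funext fun N => by
    haveI := isProbabilityMeasure_localGibbsLaw (a₀ := fun _ => a) (θ₀ := fun _ => θ)
      (u₀ := fun _ => (0 : V3)) continuous_const continuous_const continuous_const
      (fun _ => ha) (fun _ => hθ) hσ N (Φ N)
    rw [hE N, measure_univ]
  rw [h1] at h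
  exact one_ne_zero (tendsto_const_nhds_iff.1 h)

end GibbsLightConeWithoutNonnegTime

open GibbsLightConeWithoutNonnegTime in
/-- **`GibbsLightCone` without `0 ≤ t` is false** (witness `a = θ = 1`, `σ = min(σ₀/2, 1/4)`,
Alexander's flows, `t = -2/c`, `δ = 1`: the threshold is `-1`, the event is everything and its
probability is `1` for every `N`). The hypothesis is load-bearing only through the sign of
`c t + δ`. [folklore] -/
theorem gibbsLightCone_false_without_nonnegTime : ¬ GibbsLightConeWithoutNonnegTime := by
  intro h
  obtain ⟨σ₀, hσ₀, c, hc, h⟩ := h 1 1 one_pos one_pos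
  obtain ⟨σ, hσ, hσlt, hσhalf⟩ := exists_sigma hσ₀
  have hc2 : c * (2 / c) = 2 := by field_simp
  refine not_tendsto_of_eq_univ one_pos one_pos (by linarith)
    (fun N => someFlow hσ hσhalf N) _ (fun N => event_eq_univ _ ?_)
    (h σ hσ hσlt _ (-(2 / c)) 1 one_pos)
  rw [mul_neg, hc2]
  norm_num

namespace GibbsLightConeWithoutPosDelta

/-- Sanity (contrapositive form): the variant is the crux minus exactly `0 < δ`. [folklore] -/
theorem not_of_not_crux : ¬ GibbsLightCone → ¬ GibbsLightConeWithoutPosDelta := by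
  intro hn h
  refine hn fun a θ ha hθ => ?_
  obtain ⟨σ₀, hσ₀, c, hc, h⟩ := h a θ ha hθ
  exact ⟨σ₀, hσ₀, c, hc, fun σ hσ hσ' Φ t ht δ _ => h σ hσ hσ' Φ t ht δ⟩

end GibbsLightConeWithoutPosDelta

open GibbsLightConeWithoutNonnegTime in
/-- **`GibbsLightCone` without `0 < δ` is false** (witness `a = θ = 1`, `σ = min(σ₀/2, 1/4)`,
Alexander's flows, `t = 0`, `δ = -1`: the event is everything, probability `1`). The honest
load-bearing content is `0 ≤ δ`: at `t = 0` the event is Gibbs-null already for `δ ≥ 0`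
(Disproof.lean `gibbs_cruxEvent_zero`). [folklore] -/
theorem gibbsLightCone_false_without_posDelta : ¬ GibbsLightConeWithoutPosDelta := by
  intro h
  obtain ⟨σ₀, hσ₀, c, hc, h⟩ := h 1 1 one_pos one_pos
  obtain ⟨σ, hσ, hσlt, hσhalf⟩ := exists_sigma hσ₀
  refine not_tendsto_of_eq_univ one_pos one_pos (by linarith)
    (fun N => someFlow hσ hσhalf N) _ (fun N => event_eq_univ _ ?_)
    (h σ hσ hσlt _ 0 le_rfl (-1))
  norm_num

end Summit.AtomisticToContinuum.HydrodynamicLimit.Theorems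

end
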